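import Mathlib
import Literature.NumberTheory.Sieve.BrunPureSieve
import Literature.NumberTheory.LFunctions.MertensTail
import HarnessLib

/-!
# Shifted primes without prime factors in an interval: an elementary sieve bound

Topic `Literature/NumberTheory/Sieve`, family `parity`.  Everything in this file is PROVED (no named
facts).  The main result, `Literature.NumberTheory.Sieve.ShiftedPrimesSieve.card_primes_shift_free_le`, is the weak form of
the "standard sieve upper bound" (2.5) of J. D. Lichtman, *Averages of the Möbius function on
shifted primes*, Quart. J. Math. 73 (2022) 729–757 (arXiv:2009.08969; held copy
`paper:arxiv-2009.08969`, PDF p. 7: "`#{p ≤ X : q ∤ p + h ∀ q ∈ [P_j, Q_j]} ≪ π(X) (log P_j/log Q_j)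
(h/φ(h))`", attributed there to Friedlander–Iwaniec, *Opera de Cribro*) that the reduction file
`MoebiusShiftedPrimesDecomposition.lean` records as the named fact
`Literature.Lichtman2020.roughShiftedPrimesBound`:

  there are `C, X₀` such that for all `X ≥ X₀`, `1 ≤ h ≤ X` and
  `log X ≤ P ≤ Q ≤ exp(log X/(40 log log X))`,
  `#{p ≤ X : p + h has no prime factor in [P, Q]} ≤ C · (X log log X / log X) · (log P / log Q)`.

## Proof

Write `y = log X`, `ℓ = log y`, `z = exp(y/(40 ℓ))` and let `𝒫` be the set of primes `q ≤ z`.  A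
prime `p ≤ X` with `p > z` such that `p + h` has no prime factor in `[P, Q]` (`⊆ [2, z]`) satisfies,
for every `q ∈ 𝒫`, neither `q ∣ p` nor (`q ∈ [P, Q]` and `q ∣ p + h`); so it suffices to bound the
number of `m ∈ [1, X]` avoiding the "events" `R_q = {q ∣ m} ∪ {q ∈ [P, Q], q ∣ m + h}`, `q ∈ 𝒫`.
By **Brun's pure sieve** (`Literature.NumberTheory.Sieve.BrunPureSieve.card_filter_forall_not_le_bonferroniSum`, the tree's
proved Bonferroni form of Cojocaru–Murty §6.1) with `r = 2⌈6ℓ⌉` terms this is at most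
`∑_{k ≤ r} (-1)^k ∑_{S ⊆ 𝒫, #S = k} A(S)`, `A(S) = #{m ≤ X : R_q(m) ∀ q ∈ S}`.  Splitting each
`R_q`, `q ∈ [P, Q]`, `q ∤ h`, into its two (disjoint) residue classes,
`A(S) = ∑_{U ⊆ S'} #{m ≤ X : ∏_{S ∖ U} q ∣ m, ∏_U q ∣ m + h}` with `S' = {q ∈ S ∩ [P, Q] : q ∤ h}`
(`card_filter_forall_or_eq_sum`), and each term is `X/∏_S q + O(1)` by the Chinese remainder
theorem for two coprime moduli (`abs_card_filter_dvd_and_dvd_add_sub_le`); hence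
`A(S) = X ν(S) + O(ω(S))` with `ω(q) = 2` or `1` and `ν(q) = ω(q)/q`
(`abs_card_filter_forall_or_sub_le`).  The signed main terms are summed by the Bonferroni
inequality for products (`Literature.NumberTheory.Sieve.BrunPureSieve.bonferroniSum_le_prod_one_sub_add`):
`≤ X (∏_{q ∈ 𝒫} (1 - ν(q)) + e_{r+1}(ν))`.  Finally
`∏ (1 - ν(q)) ≤ ∏_{q ≤ z} (1 - 1/q) · ∏_{q ∈ [P,Q], q ∤ h} (1 - 1/q) ≤ C (ℓ/y) (log P/log Q)` by the
tree's explicit Mertens bounds (`Literature.NumberTheory.LFunctions.MertensBound.prod_one_sub_inv_prime_Icc_le`, used for `[2, z]`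
and for `[P, Q]`; the primes `q ∣ h` of `[P, Q]` number at most `log h/log P ≤ y/ℓ` and contribute a
factor `≤ e²`), Rankin's bound (`Literature.NumberTheory.Sieve.BrunPureSieve.esymm_le_inv_pow_mul_exp` with `λ = 4`) gives
`e_{r+1}(ν) ≤ e^{32} y^{-8}`, the `O`-terms total `≤ 2^r ∑_{k ≤ r} C(#𝒫, k) ≤ (4z)^r ≤ X^{1/2}`, and
the primes `p ≤ z` number `≤ z + 1`; since `log P/log Q ≥ 40 ℓ²/y`, everything is
`≪ X (ℓ/y) (log P/log Q)`.

## References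

* J. D. Lichtman, *Averages of the Möbius function on shifted primes*, Quart. J. Math. 73 (2022),
  729–757; arXiv:2009.08969, display (2.5). [Lichtman2020]
* A. C. Cojocaru, M. R. Murty, *An Introduction to Sieve Methods and their Applications* (2005),
  §6.1 (Brun's pure sieve). [CojocaruMurty2005]
* G. H. Hardy, E. M. Wright, *An Introduction to the Theory of Numbers*, Thms 427–429 (Mertens).
  [HardyWright2008]
-/

open Finset Real Filter

namespace Literature.NumberTheory.Sieve

namespace ShiftedPrimesSieve

/-! ### Counting in two coprime residue classes -/

/-- **CRT count.** For coprime `d₁, d₂ ≥ 1` and any `X, h`: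
`|#{m ∈ [1, X] : d₁ ∣ m, d₂ ∣ m + h} - X/(d₁ d₂)| ≤ 1` (the condition is `d₁ d₂ ∣ m + t` for the
`t` with `t ≡ 0 (d₁)`, `t ≡ h (d₂)`). [folklore] -/
theorem abs_card_filter_dvd_and_dvd_add_sub_le {d₁ d₂ : ℕ} (h₁ : 1 ≤ d₁) (h₂ : 1 ≤ d₂)
    (hco : d₁.Coprime d₂) (X h : ℕ) :
    |(#{m ∈ Icc 1 X | d₁ ∣ m ∧ d₂ ∣ m + h} : ℝ) - (X : ℝ) / ((d₁ : ℝ) * d₂)| ≤ 1 := by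
  obtain ⟨t, ht₁, ht₂⟩ := Nat.chineseRemainder hco 0 h
  have hd₁t : d₁ ∣ t := Nat.modEq_zero_iff_dvd.mp ht₁
  have hiff : ∀ m : ℕ, (d₁ ∣ m ∧ d₂ ∣ m + h) ↔ d₁ * d₂ ∣ m + t := by
    intro m
    have e1 : d₁ ∣ m ↔ d₁ ∣ m + t := (Nat.dvd_add_left hd₁t).symm
    have e2 : d₂ ∣ m + h ↔ d₂ ∣ m + t :=
      ((Nat.ModEq.add_left m ht₂).dvd_iff dvd_rfl).symm
    rw [e1, e2]
    constructor
    · rintro ⟨a, b⟩; exact hco.mul_dvd_of_dvd_of_dvd a b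
    · intro hab
      exact ⟨(dvd_mul_right d₁ d₂).trans hab, (dvd_mul_left d₂ d₁).trans hab⟩
  have hfilter : {m ∈ Icc 1 X | d₁ ∣ m ∧ d₂ ∣ m + h} = {m ∈ Icc 1 X | d₁ * d₂ ∣ m + t} :=
    Finset.filter_congr fun m _ => hiff m
  have hmap : #{m ∈ Icc 1 X | d₁ * d₂ ∣ m + t} = #{n ∈ Icc (1 + t) (X + t) | d₁ * d₂ ∣ n} := by
    rw [← Finset.map_add_right_Icc, Finset.filter_map, Finset.card_map]
    rfl
  rw [hfilter, hmap]
  have hd : 1 ≤ d₁ * d₂ := Nat.one_le_iff_ne_zero.mpr (Nat.mul_ne_zero (by omega) (by omega))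
  have := BrunPureSieve.abs_card_Icc_filter_dvd_sub_le (a := 1 + t) (b := X + t) (by omega)
    (by omega) hd
  convert this using 3
  push_cast
  ring

/-! ### Splitting the events `q ∣ m ∨ (J q ∧ q ∣ m + h)` -/

/-- Pointwise splitting of one event: for any `q, m, h` and any proposition `J`,
`[q ∣ m ∨ (J ∧ q ∣ m + h)] = [q ∣ m] + [(J ∧ q ∤ h) ∧ q ∣ m + h]` (the two classes are disjoint when
`q ∤ h`, and coincide when `q ∣ h`). [folklore] -/
theorem ite_dvd_or_eq_add (q m h : ℕ) (J : Prop) [Decidable J] :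
    (if q ∣ m ∨ (J ∧ q ∣ m + h) then (1 : ℝ) else 0) =
      (if q ∣ m then (1 : ℝ) else 0) + if (J ∧ ¬ q ∣ h) ∧ q ∣ m + h then (1 : ℝ) else 0 := by
  by_cases hm : q ∣ m
  · have : ¬ ((J ∧ ¬ q ∣ h) ∧ q ∣ m + h) := by
      rintro ⟨⟨-, hnh⟩, hmh⟩
      exact hnh ((Nat.dvd_add_right hm).mp hmh)
    simp [hm, this]
  · by_cases hJ : J
    · by_cases hmh : q ∣ m + h
      · have hnh : ¬ q ∣ h := fun hh => hm ((Nat.dvd_add_left hh).mp hmh)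
        simp [hm, hJ, hmh, hnh]
      · simp [hm, hmh]
    · simp [hm, hJ]

/-- **Splitting of `A(S)`.** For a finite set `S` of primes and a decidable predicate `J`,
`#{m ∈ [1, X] : ∀ q ∈ S, q ∣ m ∨ (J q ∧ q ∣ m + h)}
  = ∑_{U ⊆ S'} #{m ∈ [1, X] : ∏_{q ∈ S ∖ U} q ∣ m ∧ ∏_{q ∈ U} q ∣ m + h}`,
`S' = {q ∈ S : J q ∧ q ∤ h}`. [folklore] -/
theorem card_filter_forall_or_eq_sum (S : Finset ℕ) (hS : ∀ q ∈ S, q.Prime) (J : ℕ → Prop)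
    [DecidablePred J] (X h : ℕ) :
    (#{m ∈ Icc 1 X | ∀ q ∈ S, q ∣ m ∨ (J q ∧ q ∣ m + h)} : ℝ) =
      ∑ U ∈ (S.filter fun q => J q ∧ ¬ q ∣ h).powerset,
        (#{m ∈ Icc 1 X | (∏ q ∈ S \ U, q) ∣ m ∧ (∏ q ∈ U, q) ∣ m + h} : ℝ) := by
  classical
  have hS'S : (S.filter fun q => J q ∧ ¬ q ∣ h) ⊆ S := Finset.filter_subset _ _
  rw [Finset.natCast_card_filter]
  simp_rw [Finset.natCast_card_filter]
  rw [Finset.sum_comm]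
  refine Finset.sum_congr rfl fun m _ => ?_
  -- pointwise identity at `m`
  have hprod : (if ∀ q ∈ S, q ∣ m ∨ (J q ∧ q ∣ m + h) then (1 : ℝ) else 0) =
      ∏ q ∈ S, ((if (J q ∧ ¬ q ∣ h) ∧ q ∣ m + h then (1 : ℝ) else 0) +
        if q ∣ m then (1 : ℝ) else 0) := by
    rw [← Finset.prod_boole]
    refine Finset.prod_congr rfl fun q _ => ?_
    rw [ite_dvd_or_eq_add, add_comm]
  rw [hprod, Finset.prod_add]
  -- the terms with `U ⊄ S'` vanish
  have hvanish : ∑ U ∈ S.powerset, (∏ q ∈ U, (if (J q ∧ ¬ q ∣ h) ∧ q ∣ m + h then (1 : ℝ) else 0)) *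
        ∏ q ∈ S \ U, (if q ∣ m then (1 : ℝ) else 0) =
      ∑ U ∈ (S.filter fun q => J q ∧ ¬ q ∣ h).powerset,
        (∏ q ∈ U, (if (J q ∧ ¬ q ∣ h) ∧ q ∣ m + h then (1 : ℝ) else 0)) *
          ∏ q ∈ S \ U, (if q ∣ m then (1 : ℝ) else 0) := by
    symm
    apply Finset.sum_subset (Finset.powerset_mono.mpr hS'S)
    intro U hU hU'
    rw [Finset.mem_powerset] at hU hU'
    obtain ⟨q, hqU, hqS'⟩ := Finset.not_subset.mp hU'
    have hq0 : (if (J q ∧ ¬ q ∣ h) ∧ q ∣ m + h then (1 : ℝ) else 0) = 0 := by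
      rw [if_neg]
      intro hc
      exact hqS' (Finset.mem_filter.mpr ⟨hU hqU, hc.1⟩)
    have hz : ∏ q ∈ U, (if (J q ∧ ¬ q ∣ h) ∧ q ∣ m + h then (1 : ℝ) else 0) = 0 :=
      Finset.prod_eq_zero hqU hq0
    rw [hz, zero_mul]
  rw [hvanish]
  refine Finset.sum_congr rfl fun U hU => ?_
  rw [Finset.mem_powerset] at hU
  have hUS : U ⊆ S := hU.trans hS'S
  have h1 : ∏ q ∈ U, (if (J q ∧ ¬ q ∣ h) ∧ q ∣ m + h then (1 : ℝ) else 0) =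
      if ∀ q ∈ U, q ∣ m + h then (1 : ℝ) else 0 := by
    rw [← Finset.prod_boole]
    refine Finset.prod_congr rfl fun q hq => ?_
    have hq' : J q ∧ ¬ q ∣ h := (Finset.mem_filter.mp (hU hq)).2
    simp [hq']
  have h2 : ∏ q ∈ S \ U, (if q ∣ m then (1 : ℝ) else 0) = if ∀ q ∈ S \ U, q ∣ m then 1 else 0 :=
    Finset.prod_boole
  rw [h1, h2]
  have e1 : (∀ q ∈ U, q ∣ m + h) ↔ (∏ q ∈ U, q) ∣ m + h :=
    BrunPureSieve.forall_prime_dvd_iff_prod_dvd (fun q hq => hS q (hUS hq)) _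
  have e2 : (∀ q ∈ S \ U, q ∣ m) ↔ (∏ q ∈ S \ U, q) ∣ m :=
    BrunPureSieve.forall_prime_dvd_iff_prod_dvd (fun q hq => hS q (Finset.sdiff_subset hq)) _
  by_cases ha : (∏ q ∈ S \ U, q) ∣ m
  · by_cases hb : (∏ q ∈ U, q) ∣ m + h
    · rw [if_pos (e1.mpr hb), if_pos (e2.mpr ha), if_pos ⟨ha, hb⟩, mul_one]
    · rw [if_neg (show ¬ (∀ q ∈ U, q ∣ m + h) from fun hc => hb (e1.mp hc)),
        if_neg (show ¬ ((∏ q ∈ S \ U, q) ∣ m ∧ (∏ q ∈ U, q) ∣ m + h) from fun hc => hb hc.2),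
        zero_mul]
  · rw [if_neg (show ¬ (∀ q ∈ S \ U, q ∣ m) from fun hc => ha (e2.mp hc)),
      if_neg (show ¬ ((∏ q ∈ S \ U, q) ∣ m ∧ (∏ q ∈ U, q) ∣ m + h) from fun hc => ha hc.1),
      mul_zero]

/-- **`A(S) = X ν(S) + O(ω(S))`.** For a finite set `S` of primes, a decidable predicate `J` and
`ω(q) = 2` if `J q ∧ q ∤ h`, `ω(q) = 1` otherwise:
`|#{m ∈ [1, X] : ∀ q ∈ S, q ∣ m ∨ (J q ∧ q ∣ m + h)} - X ∏_{q ∈ S} ω(q)/q| ≤ ∏_{q ∈ S} ω(q)`.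
[folklore] -/
theorem abs_card_filter_forall_or_sub_le (S : Finset ℕ) (hS : ∀ q ∈ S, q.Prime) (J : ℕ → Prop)
    [DecidablePred J] (X h : ℕ) :
    |(#{m ∈ Icc 1 X | ∀ q ∈ S, q ∣ m ∨ (J q ∧ q ∣ m + h)} : ℝ) -
        X * ∏ q ∈ S, (if J q ∧ ¬ q ∣ h then (2 : ℝ) else 1) / q| ≤
      ∏ q ∈ S, (if J q ∧ ¬ q ∣ h then (2 : ℝ) else 1) := by
  classical
  have hS'S : (S.filter fun q => J q ∧ ¬ q ∣ h) ⊆ S := Finset.filter_subset _ _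
  have hd0 : (0 : ℝ) < ((∏ q ∈ S, q : ℕ) : ℝ) := by
    rw [Nat.cast_prod]
    exact Finset.prod_pos fun q hq => by exact_mod_cast (hS q hq).pos
  -- `∏ ω = 2^{#S'}` and `∏ ω/q = 2^{#S'}/d`
  have hω : ∏ q ∈ S, (if J q ∧ ¬ q ∣ h then (2 : ℝ) else 1) =
      2 ^ #(S.filter fun q => J q ∧ ¬ q ∣ h) := by
    rw [Finset.prod_ite, Finset.prod_const, Finset.prod_const_one, mul_one]
  have hν : ∏ q ∈ S, (if J q ∧ ¬ q ∣ h then (2 : ℝ) else 1) / q =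
      2 ^ #(S.filter fun q => J q ∧ ¬ q ∣ h) / ((∏ q ∈ S, q : ℕ) : ℝ) := by
    rw [Finset.prod_div_distrib, hω, Nat.cast_prod]
  rw [hω, hν, card_filter_forall_or_eq_sum S hS J X h]
  -- each term is `X/d + θ`
  have hterm : ∀ U ∈ (S.filter fun q => J q ∧ ¬ q ∣ h).powerset,
      |(#{m ∈ Icc 1 X | (∏ q ∈ S \ U, q) ∣ m ∧ (∏ q ∈ U, q) ∣ m + h} : ℝ) -
        X / ((∏ q ∈ S, q : ℕ) : ℝ)| ≤ 1 := by
    intro U hU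
    rw [Finset.mem_powerset] at hU
    have hUS : U ⊆ S := hU.trans hS'S
    have hone : ∀ T ⊆ S, 1 ≤ ∏ q ∈ T, q := fun T hT =>
      Nat.one_le_iff_ne_zero.mpr (Finset.prod_ne_zero_iff.mpr fun q hq => (hS q (hT hq)).ne_zero)
    have hco : (∏ q ∈ S \ U, q).Coprime (∏ q ∈ U, q) := by
      refine Nat.Coprime.prod_left fun q hq => Nat.Coprime.prod_right fun q' hq' => ?_
      have hne : q ≠ q' := by
        rintro rfl
        exact (Finset.mem_sdiff.mp hq).2 hq'
      exact (Nat.coprime_primes (hS q (Finset.sdiff_subset hq)) (hS q' (hUS hq'))).mpr hne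
    have := abs_card_filter_dvd_and_dvd_add_sub_le (hone _ Finset.sdiff_subset) (hone _ hUS) hco X h
    have hdd : ((∏ q ∈ S \ U, q : ℕ) : ℝ) * ((∏ q ∈ U, q : ℕ) : ℝ) = ((∏ q ∈ S, q : ℕ) : ℝ) := by
      rw [← Nat.cast_mul, Finset.prod_sdiff hUS]
    rwa [hdd] at this
  calc |∑ U ∈ (S.filter fun q => J q ∧ ¬ q ∣ h).powerset,
          (#{m ∈ Icc 1 X | (∏ q ∈ S \ U, q) ∣ m ∧ (∏ q ∈ U, q) ∣ m + h} : ℝ) -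
          X * (2 ^ #(S.filter fun q => J q ∧ ¬ q ∣ h) / ((∏ q ∈ S, q : ℕ) : ℝ))|
      = |∑ U ∈ (S.filter fun q => J q ∧ ¬ q ∣ h).powerset,
          ((#{m ∈ Icc 1 X | (∏ q ∈ S \ U, q) ∣ m ∧ (∏ q ∈ U, q) ∣ m + h} : ℝ) -
            X / ((∏ q ∈ S, q : ℕ) : ℝ))| := by
        congr 1
        rw [Finset.sum_sub_distrib, Finset.sum_const, Finset.card_powerset, nsmul_eq_mul]
        push_cast
        ring
    _ ≤ ∑ U ∈ (S.filter fun q => J q ∧ ¬ q ∣ h).powerset,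
          |(#{m ∈ Icc 1 X | (∏ q ∈ S \ U, q) ∣ m ∧ (∏ q ∈ U, q) ∣ m + h} : ℝ) -
            X / ((∏ q ∈ S, q : ℕ) : ℝ)| := Finset.abs_sum_le_sum_abs _ _
    _ ≤ ∑ U ∈ (S.filter fun q => J q ∧ ¬ q ∣ h).powerset, (1 : ℝ) := Finset.sum_le_sum hterm
    _ = 2 ^ #(S.filter fun q => J q ∧ ¬ q ∣ h) := by
        rw [Finset.sum_const, Finset.card_powerset]; simp

/-! ### Brun's pure sieve for the events `q ∣ m ∨ (J q ∧ q ∣ m + h)` -/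

/-- **Brun's pure sieve, two residue classes.** For a finite set `𝒫` of primes, a decidable
predicate `J`, `h`, `X` and even `r`, with `ω(q) ∈ {1, 2}` as above and `ν(q) = ω(q)/q`:
`#{m ∈ [1, X] : ∀ q ∈ 𝒫, ¬(q ∣ m ∨ (J q ∧ q ∣ m + h))}
  ≤ X (∏_{q ∈ 𝒫} (1 - ν(q)) + ∑_{S ⊆ 𝒫, #S = r+1} ∏_{q ∈ S} ν(q)) + 2^r (#𝒫 + 1)^r`
(Cojocaru–Murty §6.1, (6.5), with the main term summed by the Bonferroni inequalities).
[cite: CojocaruMurty2005, §6.1 (6.5)] -/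
theorem card_sifted_le (Pz : Finset ℕ) (hP : ∀ q ∈ Pz, q.Prime) (J : ℕ → Prop) [DecidablePred J]
    (X h : ℕ) {r : ℕ} (hr : Even r) :
    (#{m ∈ Icc 1 X | ∀ q ∈ Pz, ¬ (q ∣ m ∨ (J q ∧ q ∣ m + h))} : ℝ) ≤
      X * (∏ q ∈ Pz, (1 - (if J q ∧ ¬ q ∣ h then (2 : ℝ) else 1) / q) +
          ∑ S ∈ Pz.powersetCard (r + 1), ∏ q ∈ S, (if J q ∧ ¬ q ∣ h then (2 : ℝ) else 1) / q) +
        2 ^ r * ((#Pz : ℝ) + 1) ^ r := by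
  classical
  have hω1 : ∀ q, 1 ≤ (if J q ∧ ¬ q ∣ h then (2 : ℝ) else 1) := fun q => by
    split_ifs <;> norm_num
  have hω2 : ∀ q, (if J q ∧ ¬ q ∣ h then (2 : ℝ) else 1) ≤ 2 := fun q => by
    split_ifs <;> norm_num
  have hν0 : ∀ q ∈ Pz, 0 ≤ (if J q ∧ ¬ q ∣ h then (2 : ℝ) else 1) / q := fun q _ =>
    div_nonneg (by linarith [hω1 q]) (Nat.cast_nonneg q)
  have hν1 : ∀ q ∈ Pz, (if J q ∧ ¬ q ∣ h then (2 : ℝ) else 1) / q ≤ 1 := fun q hq => by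
    have hq2 : (2 : ℝ) ≤ q := by exact_mod_cast (hP q hq).two_le
    rw [div_le_one (by linarith)]
    exact (hω2 q).trans hq2
  -- Step 1: Bonferroni counting
  have step1 := BrunPureSieve.card_filter_forall_not_le_bonferroniSum (Icc 1 X) Pz
    (fun q m => q ∣ m ∨ (J q ∧ q ∣ m + h)) hr
  -- Step 2: each term
  have step2 : ∀ k ∈ range (r + 1), ∀ S ∈ Pz.powersetCard k,
      (-1 : ℝ) ^ k * (#{m ∈ Icc 1 X | ∀ q ∈ S, q ∣ m ∨ (J q ∧ q ∣ m + h)} : ℝ) ≤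
        (-1 : ℝ) ^ k * (X * ∏ q ∈ S, (if J q ∧ ¬ q ∣ h then (2 : ℝ) else 1) / q) + 2 ^ r := by
    intro k hk S hS
    have hSP : S ⊆ Pz := (Finset.mem_powersetCard.mp hS).1
    have hSk : #S = k := (Finset.mem_powersetCard.mp hS).2
    have hkr : k ≤ r := Nat.lt_succ_iff.mp (Finset.mem_range.mp hk)
    have habs := abs_card_filter_forall_or_sub_le S (fun q hq => hP q (hSP hq)) J X h
    have hωS : ∏ q ∈ S, (if J q ∧ ¬ q ∣ h then (2 : ℝ) else 1) ≤ 2 ^ r := by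
      calc ∏ q ∈ S, (if J q ∧ ¬ q ∣ h then (2 : ℝ) else 1) ≤ ∏ q ∈ S, (2 : ℝ) :=
            Finset.prod_le_prod (fun q _ => by linarith [hω1 q]) fun q _ => hω2 q
        _ = 2 ^ k := by rw [Finset.prod_const, hSk]
        _ ≤ 2 ^ r := pow_le_pow_right₀ (by norm_num) hkr
    rw [abs_le] at habs
    rcases neg_one_pow_eq_or ℝ k with h1 | h1 <;> rw [h1]
    · linarith [habs.2]
    · linarith [habs.1]
  -- Step 3: sum up
  have step3 : ∑ k ∈ range (r + 1), (-1 : ℝ) ^ k *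
      ∑ S ∈ Pz.powersetCard k, (#{m ∈ Icc 1 X | ∀ q ∈ S, q ∣ m ∨ (J q ∧ q ∣ m + h)} : ℝ) ≤
      X * ∑ k ∈ range (r + 1), (-1 : ℝ) ^ k * ∑ S ∈ Pz.powersetCard k,
          ∏ q ∈ S, (if J q ∧ ¬ q ∣ h then (2 : ℝ) else 1) / q +
        2 ^ r * ∑ k ∈ range (r + 1), ((#Pz).choose k : ℝ) := by
    calc ∑ k ∈ range (r + 1), (-1 : ℝ) ^ k *
          ∑ S ∈ Pz.powersetCard k, (#{m ∈ Icc 1 X | ∀ q ∈ S, q ∣ m ∨ (J q ∧ q ∣ m + h)} : ℝ)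
        = ∑ k ∈ range (r + 1), ∑ S ∈ Pz.powersetCard k,
            (-1 : ℝ) ^ k * (#{m ∈ Icc 1 X | ∀ q ∈ S, q ∣ m ∨ (J q ∧ q ∣ m + h)} : ℝ) := by
          simp_rw [Finset.mul_sum]
      _ ≤ ∑ k ∈ range (r + 1), ∑ S ∈ Pz.powersetCard k,
            ((-1 : ℝ) ^ k * (X * ∏ q ∈ S, (if J q ∧ ¬ q ∣ h then (2 : ℝ) else 1) / q) + 2 ^ r) :=
          Finset.sum_le_sum fun k hk => Finset.sum_le_sum fun S hS => step2 k hk S hS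
      _ = _ := by
          simp_rw [Finset.sum_add_distrib, Finset.sum_const, nsmul_eq_mul, Finset.card_powersetCard,
            Finset.mul_sum]
          congr 1
          · exact Finset.sum_congr rfl fun k _ => Finset.sum_congr rfl fun S _ => by ring
          · exact Finset.sum_congr rfl fun k _ => by ring
  -- Step 4: Bonferroni for the product, and the binomial sum
  have step4 := BrunPureSieve.bonferroniSum_le_prod_one_sub_add Pz
    (fun q => (if J q ∧ ¬ q ∣ h then (2 : ℝ) else 1) / q) hν0 hν1 hr
  have step5 := BrunPureSieve.sum_range_choose_le_pow (#Pz) r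
  have hX0 : (0 : ℝ) ≤ X := Nat.cast_nonneg X
  have h2r : (0 : ℝ) ≤ 2 ^ r := by positivity
  calc (#{m ∈ Icc 1 X | ∀ q ∈ Pz, ¬ (q ∣ m ∨ (J q ∧ q ∣ m + h))} : ℝ) ≤ _ := step1
    _ ≤ _ := step3
    _ ≤ _ := by gcongr

/-! ### The main term: Mertens-type bounds -/

/-- The primes `q ≥ P` dividing `h ≥ 1` are few: `#{q} · log P ≤ log h`. [folklore] -/
theorem card_mul_log_le_log {P : ℝ} (hP : 1 ≤ P) {h : ℕ} (hh : 1 ≤ h) (F : Finset ℕ)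
    (hF : ∀ q ∈ F, q.Prime ∧ q ∣ h ∧ P ≤ (q : ℝ)) :
    #F * Real.log P ≤ Real.log h := by
  have hprod_dvd : (∏ q ∈ F, q) ∣ h :=
    Finset.prod_primes_dvd h (fun q hq => (hF q hq).1.prime) fun q hq => (hF q hq).2.1
  have hprod_le : ((∏ q ∈ F, q : ℕ) : ℝ) ≤ h := by exact_mod_cast Nat.le_of_dvd (by omega) hprod_dvd
  have hP0 : 0 < P := by linarith
  have hpow : P ^ #F ≤ ((∏ q ∈ F, q : ℕ) : ℝ) := by
    rw [Nat.cast_prod, ← Finset.prod_const]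
    exact Finset.prod_le_prod (fun q _ => hP0.le) fun q hq => (hF q hq).2.2
  have := Real.log_le_log (pow_pos hP0 _) (hpow.trans hprod_le)
  rwa [Real.log_pow] at this

/-- `∏_{q ∈ F} (1 - 1/q) ≥ exp(-2 #F / P)` for a set `F` of integers `q ≥ P ≥ 2`. [folklore] -/
theorem exp_neg_le_prod_one_sub_inv {P : ℝ} (hP : 2 ≤ P) (F : Finset ℕ)
    (hF : ∀ q ∈ F, P ≤ (q : ℝ)) :
    Real.exp (-(2 * #F / P)) ≤ ∏ q ∈ F, (1 - (q : ℝ)⁻¹) := by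
  have hP0 : 0 < P := by linarith
  have hq2 : ∀ q ∈ F, (2 : ℝ) ≤ q := fun q hq => hP.trans (hF q hq)
  calc Real.exp (-(2 * #F / P)) = ∏ _q ∈ F, Real.exp (-(2 / P)) := by
        rw [Finset.prod_const, ← Real.exp_nat_mul]; congr 1; ring
    _ ≤ ∏ q ∈ F, Real.exp (-(1 / ((q : ℝ) - 1))) := by
        refine Finset.prod_le_prod (fun q _ => (Real.exp_pos _).le) fun q hq => ?_
        refine Real.exp_le_exp.mpr (neg_le_neg ?_)
        have h2 := hq2 q hq
        have hq1 : 0 < (q : ℝ) - 1 := by linarith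
        rw [div_le_div_iff₀ hq1 hP0]
        nlinarith [hF q hq]
    _ ≤ ∏ q ∈ F, (1 - (q : ℝ)⁻¹) := by
        refine Finset.prod_le_prod (fun q _ => (Real.exp_pos _).le) fun q hq => ?_
        have h2 := hq2 q hq
        have := LFunctions.MertensBound.exp_neg_inv_pred_le q (by exact_mod_cast h2)
        simpa [one_div] using this

/-- **Main-term bound.** For `2 ≤ P ≤ Q ≤ z` and `h`, with `𝒫 = {q prime : 2 ≤ q ≤ z}`,
`J q = (⌈P⌉ ≤ q ≤ ⌊Q⌋)` and `F = {q ∈ [P, Q] prime : q ∣ h}`: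
`∏_{q ∈ 𝒫} (1 - ω(q)/q) ≤ e^{6/log 2} (log 2/log z) · e^{6/log P} (log P/log Q) · exp(2 #F/P)`.
[cite: HardyWright2008, Thm 429 (§22.8)] -/
theorem prod_one_sub_nu_le {P Q z : ℝ} (hP : 2 ≤ P) (hPQ : P ≤ Q) (hQz : Q ≤ z) (h : ℕ) :
    ∏ q ∈ (Icc ⌈(2 : ℝ)⌉₊ ⌊z⌋₊).filter Nat.Prime,
        (1 - (if (⌈P⌉₊ ≤ q ∧ q ≤ ⌊Q⌋₊) ∧ ¬ q ∣ h then (2 : ℝ) else 1) / q) ≤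
      (Real.exp (6 / Real.log 2) * (Real.log 2 / Real.log z)) *
        (Real.exp (6 / Real.log P) * (Real.log P / Real.log Q)) *
        Real.exp (2 * #(((Icc ⌈P⌉₊ ⌊Q⌋₊).filter Nat.Prime).filter (· ∣ h)) / P) := by
  classical
  have h2z : (2 : ℝ) ≤ z := hP.trans (hPQ.trans hQz)
  have hQ0 : 0 ≤ Q := by linarith
  have hprime : ∀ q ∈ (Icc ⌈(2 : ℝ)⌉₊ ⌊z⌋₊).filter Nat.Prime, q.Prime := fun q hq =>
    (Finset.mem_filter.mp hq).2
  have hq2 : ∀ q ∈ (Icc ⌈(2 : ℝ)⌉₊ ⌊z⌋₊).filter Nat.Prime, (2 : ℝ) ≤ q := fun q hq => by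
    exact_mod_cast (hprime q hq).two_le
  -- pointwise: `1 - ω/q ≤ (1 - 1/q) * (if J ∧ ∤ then 1 - 1/q else 1)`
  have hpt : ∀ q ∈ (Icc ⌈(2 : ℝ)⌉₊ ⌊z⌋₊).filter Nat.Prime,
      (1 - (if (⌈P⌉₊ ≤ q ∧ q ≤ ⌊Q⌋₊) ∧ ¬ q ∣ h then (2 : ℝ) else 1) / q) ≤
      (1 - (q : ℝ)⁻¹) * (if (⌈P⌉₊ ≤ q ∧ q ≤ ⌊Q⌋₊) ∧ ¬ q ∣ h then (1 - (q : ℝ)⁻¹) else 1) := by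
    intro q hq
    have hq0 : (0 : ℝ) < q := by linarith [hq2 q hq]
    split_ifs
    · have : (1 - (q : ℝ)⁻¹) * (1 - (q : ℝ)⁻¹) = 1 - 2 / q + (q : ℝ)⁻¹ ^ 2 := by field_simp; ring
      rw [this]
      nlinarith [sq_nonneg ((q : ℝ)⁻¹)]
    · rw [mul_one, one_div]
  have hnn : ∀ q ∈ (Icc ⌈(2 : ℝ)⌉₊ ⌊z⌋₊).filter Nat.Prime,
      0 ≤ 1 - (if (⌈P⌉₊ ≤ q ∧ q ≤ ⌊Q⌋₊) ∧ ¬ q ∣ h then (2 : ℝ) else 1) / q := by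
    intro q hq
    rw [sub_nonneg, div_le_one (by linarith [hq2 q hq])]
    split_ifs <;> linarith [hq2 q hq]
  have hstep1 : ∏ q ∈ (Icc ⌈(2 : ℝ)⌉₊ ⌊z⌋₊).filter Nat.Prime,
        (1 - (if (⌈P⌉₊ ≤ q ∧ q ≤ ⌊Q⌋₊) ∧ ¬ q ∣ h then (2 : ℝ) else 1) / q) ≤
      (∏ q ∈ (Icc ⌈(2 : ℝ)⌉₊ ⌊z⌋₊).filter Nat.Prime, (1 - (q : ℝ)⁻¹)) *
        ∏ q ∈ ((Icc ⌈(2 : ℝ)⌉₊ ⌊z⌋₊).filter Nat.Prime).filter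
          (fun q => (⌈P⌉₊ ≤ q ∧ q ≤ ⌊Q⌋₊) ∧ ¬ q ∣ h), (1 - (q : ℝ)⁻¹) := by
    calc _ ≤ ∏ q ∈ (Icc ⌈(2 : ℝ)⌉₊ ⌊z⌋₊).filter Nat.Prime, ((1 - (q : ℝ)⁻¹) *
          (if (⌈P⌉₊ ≤ q ∧ q ≤ ⌊Q⌋₊) ∧ ¬ q ∣ h then (1 - (q : ℝ)⁻¹) else 1)) :=
          Finset.prod_le_prod hnn hpt
      _ = _ := by
          rw [Finset.prod_mul_distrib]
          congr 1
          exact (Finset.prod_filter _ _).symm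
  -- identify the filtered set: `Pz.filter (J ∧ ∤ h) = PQ.filter (∤ h)`
  have hfilt : ((Icc ⌈(2 : ℝ)⌉₊ ⌊z⌋₊).filter Nat.Prime).filter
        (fun q => (⌈P⌉₊ ≤ q ∧ q ≤ ⌊Q⌋₊) ∧ ¬ q ∣ h) =
      ((Icc ⌈P⌉₊ ⌊Q⌋₊).filter Nat.Prime).filter (fun q => ¬ q ∣ h) := by
    ext q
    simp only [Finset.mem_filter, Finset.mem_Icc, Nat.ceil_ofNat]
    constructor
    · rintro ⟨⟨-, hq⟩, ⟨hPq, hqQ⟩, hnd⟩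
      exact ⟨⟨⟨hPq, hqQ⟩, hq⟩, hnd⟩
    · rintro ⟨⟨⟨hPq, hqQ⟩, hq⟩, hnd⟩
      refine ⟨⟨⟨hq.two_le, ?_⟩, hq⟩, ⟨hPq, hqQ⟩, hnd⟩
      exact hqQ.trans (Nat.floor_le_floor hQz)
  rw [hfilt] at hstep1
  -- Mertens for `[2, z]` and for `[P, Q]`
  have hM1 : ∏ q ∈ (Icc ⌈(2 : ℝ)⌉₊ ⌊z⌋₊).filter Nat.Prime, (1 - (q : ℝ)⁻¹) ≤
      Real.exp (6 / Real.log 2) * (Real.log 2 / Real.log z) :=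
    LFunctions.MertensBound.prod_one_sub_inv_prime_Icc_le le_rfl h2z
  have hM2 : ∏ q ∈ (Icc ⌈P⌉₊ ⌊Q⌋₊).filter Nat.Prime, (1 - (q : ℝ)⁻¹) ≤
      Real.exp (6 / Real.log P) * (Real.log P / Real.log Q) :=
    LFunctions.MertensBound.prod_one_sub_inv_prime_Icc_le hP hPQ
  -- split `PQ` into `∤ h` and `∣ h`
  have hsplit : (∏ q ∈ ((Icc ⌈P⌉₊ ⌊Q⌋₊).filter Nat.Prime).filter (fun q => ¬ q ∣ h),
        (1 - (q : ℝ)⁻¹)) *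
      ∏ q ∈ ((Icc ⌈P⌉₊ ⌊Q⌋₊).filter Nat.Prime).filter (· ∣ h), (1 - (q : ℝ)⁻¹) =
      ∏ q ∈ (Icc ⌈P⌉₊ ⌊Q⌋₊).filter Nat.Prime, (1 - (q : ℝ)⁻¹) := by
    rw [mul_comm]
    exact Finset.prod_filter_mul_prod_filter_not _ (· ∣ h) _
  have hPQ2 : ∀ q ∈ (Icc ⌈P⌉₊ ⌊Q⌋₊).filter Nat.Prime, P ≤ (q : ℝ) := fun q hq => by
    have := (Finset.mem_Icc.mp (Finset.mem_filter.mp hq).1).1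
    exact Nat.ceil_le.mp this
  have hFlow : Real.exp (-(2 * #(((Icc ⌈P⌉₊ ⌊Q⌋₊).filter Nat.Prime).filter (· ∣ h)) / P)) ≤
      ∏ q ∈ ((Icc ⌈P⌉₊ ⌊Q⌋₊).filter Nat.Prime).filter (· ∣ h), (1 - (q : ℝ)⁻¹) :=
    exp_neg_le_prod_one_sub_inv hP _ fun q hq => hPQ2 q (Finset.mem_filter.mp hq).1
  have hFpos : 0 < ∏ q ∈ ((Icc ⌈P⌉₊ ⌊Q⌋₊).filter Nat.Prime).filter (· ∣ h), (1 - (q : ℝ)⁻¹) :=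
    lt_of_lt_of_le (Real.exp_pos _) hFlow
  have hlogP : 0 < Real.log P := Real.log_pos (by linarith)
  have hlogQ : 0 < Real.log Q := Real.log_pos (by linarith)
  have hE0 : 0 ≤ Real.exp (6 / Real.log P) * (Real.log P / Real.log Q) := by positivity
  have hPQ' : ∏ q ∈ ((Icc ⌈P⌉₊ ⌊Q⌋₊).filter Nat.Prime).filter (fun q => ¬ q ∣ h), (1 - (q : ℝ)⁻¹) ≤
      (Real.exp (6 / Real.log P) * (Real.log P / Real.log Q)) *
        Real.exp (2 * #(((Icc ⌈P⌉₊ ⌊Q⌋₊).filter Nat.Prime).filter (· ∣ h)) / P) := by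
    have h1 : ∏ q ∈ ((Icc ⌈P⌉₊ ⌊Q⌋₊).filter Nat.Prime).filter (fun q => ¬ q ∣ h), (1 - (q : ℝ)⁻¹) =
        (∏ q ∈ (Icc ⌈P⌉₊ ⌊Q⌋₊).filter Nat.Prime, (1 - (q : ℝ)⁻¹)) *
          (∏ q ∈ ((Icc ⌈P⌉₊ ⌊Q⌋₊).filter Nat.Prime).filter (· ∣ h), (1 - (q : ℝ)⁻¹))⁻¹ := by
      rw [← hsplit, mul_inv_cancel_right₀ hFpos.ne']
    have h2 : (∏ q ∈ ((Icc ⌈P⌉₊ ⌊Q⌋₊).filter Nat.Prime).filter (· ∣ h), (1 - (q : ℝ)⁻¹))⁻¹ ≤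
        Real.exp (2 * #(((Icc ⌈P⌉₊ ⌊Q⌋₊).filter Nat.Prime).filter (· ∣ h)) / P) :=
      calc (∏ q ∈ ((Icc ⌈P⌉₊ ⌊Q⌋₊).filter Nat.Prime).filter (· ∣ h), (1 - (q : ℝ)⁻¹))⁻¹
          ≤ (Real.exp (-(2 * #(((Icc ⌈P⌉₊ ⌊Q⌋₊).filter Nat.Prime).filter (· ∣ h)) / P)))⁻¹ :=
            inv_anti₀ (Real.exp_pos _) hFlow
        _ = _ := by rw [Real.exp_neg, inv_inv]
    rw [h1]
    exact mul_le_mul hM2 h2 (inv_nonneg.mpr hFpos.le) hE0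
  have hPz0 : 0 ≤ ∏ q ∈ (Icc ⌈(2 : ℝ)⌉₊ ⌊z⌋₊).filter Nat.Prime, (1 - (q : ℝ)⁻¹) :=
    Finset.prod_nonneg fun q hq => by
      rw [sub_nonneg]; exact inv_le_one_of_one_le₀ (by linarith [hq2 q hq])
  have hPQ'0 : 0 ≤ ∏ q ∈ ((Icc ⌈P⌉₊ ⌊Q⌋₊).filter Nat.Prime).filter (fun q => ¬ q ∣ h),
      (1 - (q : ℝ)⁻¹) :=
    Finset.prod_nonneg fun q hq => by
      have : (2 : ℝ) ≤ q := hP.trans (hPQ2 q (Finset.mem_filter.mp hq).1)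
      rw [sub_nonneg]; exact inv_le_one_of_one_le₀ (by linarith)
  calc _ ≤ _ := hstep1
    _ ≤ (Real.exp (6 / Real.log 2) * (Real.log 2 / Real.log z)) *
          ((Real.exp (6 / Real.log P) * (Real.log P / Real.log Q)) *
            Real.exp (2 * #(((Icc ⌈P⌉₊ ⌊Q⌋₊).filter Nat.Prime).filter (· ∣ h)) / P)) :=
        mul_le_mul hM1 hPQ' hPQ'0 (hPz0.trans hM1)
    _ = _ := by ring

/-! ### Numerical lemmas -/

/-- `log 4 ∈ [4/3, 7/5]`. [folklore] -/
theorem log_four_bounds : (4 : ℝ) / 3 ≤ Real.log 4 ∧ Real.log 4 ≤ 7 / 5 := by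
  have h4 : Real.log 4 = 2 * Real.log 2 := by
    rw [show (4 : ℝ) = 2 ^ 2 by norm_num, Real.log_pow]; push_cast; ring
  rw [h4]
  constructor <;> linarith [Real.log_two_gt_d9, Real.log_two_lt_d9]

/-- **Rankin term.** With `𝒫` the primes of `[2, z]`, `z ≥ 2`, `log log z ≤ ℓ`, `y = e^ℓ` and
`r ≥ 12 ℓ`: `e_{r+1}(ν) ≤ 4^{-(r+1)} exp(4 ∑_{q ≤ z} 2/q) ≤ e^{32}/y^8`, for any weights
`ν(q) = ω(q)/q` with `0 ≤ ω(q) ≤ 2`. [folklore] -/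
theorem rankin_term_le {z ℓ y : ℝ} (hz2 : 2 ≤ z) (hℓz : Real.log (Real.log z) ≤ ℓ)
    (hy0 : 0 < y) (hyℓ : Real.log y = ℓ) (ω : ℕ → ℝ) (hω0 : ∀ q, 0 ≤ ω q) (hω2 : ∀ q, ω q ≤ 2)
    {r : ℕ} (hr : 12 * ℓ ≤ r) :
    ∑ S ∈ ((Icc ⌈(2 : ℝ)⌉₊ ⌊z⌋₊).filter Nat.Prime).powersetCard (r + 1), ∏ q ∈ S, ω q / q ≤
      Real.exp 32 / y ^ 8 := by
  have hν0 : ∀ q ∈ (Icc ⌈(2 : ℝ)⌉₊ ⌊z⌋₊).filter Nat.Prime, 0 ≤ ω q / q := fun q _ =>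
    div_nonneg (hω0 q) (Nat.cast_nonneg q)
  refine (BrunPureSieve.esymm_le_inv_pow_mul_exp _ _ hν0 (r + 1) (lam := 4) (by norm_num)).trans ?_
  have hsum : ∑ q ∈ (Icc ⌈(2 : ℝ)⌉₊ ⌊z⌋₊).filter Nat.Prime, ω q / q ≤ 2 * ℓ + 8 := by
    have h1 : ∑ q ∈ (Icc ⌈(2 : ℝ)⌉₊ ⌊z⌋₊).filter Nat.Prime, ω q / q ≤
        ∑ q ∈ (Icc ⌈(2 : ℝ)⌉₊ ⌊z⌋₊).filter Nat.Prime, 2 * ((1 : ℝ) / q) := by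
      refine Finset.sum_le_sum fun q hq => ?_
      rw [← mul_div_assoc, mul_one]
      exact div_le_div_of_nonneg_right (hω2 q) (Nat.cast_nonneg q)
    have h2 : ∑ q ∈ (Icc ⌈(2 : ℝ)⌉₊ ⌊z⌋₊).filter Nat.Prime, (1 : ℝ) / q ≤ Real.log (Real.log z) + 4 :=
      LFunctions.MertensBound.sum_inv_prime_Icc_le hz2
    rw [← Finset.mul_sum] at h1
    linarith
  have hpow : ((4 : ℝ) ^ (r + 1))⁻¹ ≤ Real.exp (-(16 * ℓ)) := by
    rw [← Real.exp_log (by positivity : (0 : ℝ) < 4 ^ (r + 1)), ← Real.exp_neg, Real.log_pow]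
    refine Real.exp_le_exp.mpr ?_
    push_cast
    nlinarith [hr, log_four_bounds.1]
  have hy8 : y ^ 8 = Real.exp (8 * ℓ) := by
    rw [← hyℓ, ← Real.exp_log (pow_pos hy0 8), Real.log_pow]; norm_num
  calc ((4 : ℝ) ^ (r + 1))⁻¹ * Real.exp (4 * ∑ q ∈ (Icc ⌈(2 : ℝ)⌉₊ ⌊z⌋₊).filter Nat.Prime, ω q / q)
      ≤ Real.exp (-(16 * ℓ)) * Real.exp (4 * (2 * ℓ + 8)) := by gcongr
    _ = Real.exp 32 / y ^ 8 := by
        rw [hy8, div_eq_mul_inv, ← Real.exp_neg, ← Real.exp_add, ← Real.exp_add]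
        congr 1; ring

/-- **Remainder term.** With `𝒫` the primes of `[2, z]`, `log z = y/(40 ℓ)`, `r ≤ 12 ℓ + 2` and
`y` large (`ℓ ≥ 1`, `y ≥ 100`, `ℓ ≤ y/400`): `2^r (#𝒫 + 1)^r ≤ (4z)^r ≤ e^{y/2}`. [folklore] -/
theorem remainder_term_le {z ℓ y : ℝ} (hz1 : 1 ≤ z) (hlogz : Real.log z = y / (40 * ℓ))
    (hℓ1 : 1 ≤ ℓ) (hy100 : 100 ≤ y) (hℓy : ℓ ≤ y / 400) {r : ℕ} (hr : (r : ℝ) ≤ 12 * ℓ + 2) :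
    (2 : ℝ) ^ r * ((#((Icc ⌈(2 : ℝ)⌉₊ ⌊z⌋₊).filter Nat.Prime) : ℝ) + 1) ^ r ≤ Real.exp (y / 2) := by
  have hz0 : 0 < z := by linarith
  have hℓ0 : 0 < ℓ := by linarith
  have hy0 : 0 < y := by linarith
  have hcard : ((#((Icc ⌈(2 : ℝ)⌉₊ ⌊z⌋₊).filter Nat.Prime) : ℝ)) ≤ z := by
    calc ((#((Icc ⌈(2 : ℝ)⌉₊ ⌊z⌋₊).filter Nat.Prime) : ℝ)) ≤ #(Icc ⌈(2 : ℝ)⌉₊ ⌊z⌋₊) := by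
          exact_mod_cast Finset.card_filter_le _ _
      _ ≤ ⌊z⌋₊ := by
          rw [Nat.card_Icc, Nat.ceil_ofNat]
          exact_mod_cast (by omega : ⌊z⌋₊ + 1 - 2 ≤ ⌊z⌋₊)
      _ ≤ z := Nat.floor_le hz0.le
  calc (2 : ℝ) ^ r * ((#((Icc ⌈(2 : ℝ)⌉₊ ⌊z⌋₊).filter Nat.Prime) : ℝ) + 1) ^ r
      ≤ (2 : ℝ) ^ r * (z + 1) ^ r := by gcongr
    _ ≤ (2 : ℝ) ^ r * (2 * z) ^ r := by gcongr; linarith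
    _ = (4 * z) ^ r := by rw [← mul_pow]; ring
    _ = Real.exp (r * (Real.log 4 + Real.log z)) := by
        rw [← Real.log_mul (by norm_num) hz0.ne', ← Real.log_rpow (by positivity),
          Real.exp_log (by positivity), Real.rpow_natCast]
    _ ≤ Real.exp (y / 2) := by
        refine Real.exp_le_exp.mpr ?_
        rw [hlogz]
        have hl4 := log_four_bounds.2
        have h0 : 0 ≤ Real.log 4 + y / (40 * ℓ) := by
          have : 0 ≤ Real.log 4 := Real.log_nonneg (by norm_num)
          positivity
        have h1 : (r : ℝ) * (Real.log 4 + y / (40 * ℓ)) ≤ (12 * ℓ + 2) * (7 / 5 + y / (40 * ℓ)) :=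
          calc (r : ℝ) * (Real.log 4 + y / (40 * ℓ)) ≤ (12 * ℓ + 2) * (Real.log 4 + y / (40 * ℓ)) :=
                mul_le_mul_of_nonneg_right hr h0
            _ ≤ (12 * ℓ + 2) * (7 / 5 + y / (40 * ℓ)) := by gcongr
        have h2 : (12 * ℓ + 2) * (7 / 5 + y / (40 * ℓ)) =
            84 / 5 * ℓ + 14 / 5 + 3 / 10 * y + y / (20 * ℓ) := by
          field_simp; ring
        have h3 : y / (20 * ℓ) ≤ y / 20 := by
          rw [div_le_div_iff₀ (by positivity) (by norm_num)]; nlinarith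
        linarith

/-- `y² = e^{2ℓ}` for `y = e^ℓ > 0`. [folklore] -/
theorem sq_eq_exp_two_mul {y ℓ : ℝ} (hy0 : 0 < y) (hyℓ : Real.log y = ℓ) : y ^ 2 = Real.exp (2 * ℓ) := by
  rw [← hyℓ, ← Real.exp_log (pow_pos hy0 2), Real.log_pow]; norm_num

/-- `2 z = 2 e^{y/(40ℓ)} ≤ e^y / y²` for `y` large. [folklore] -/
theorem two_mul_z_le {ℓ y : ℝ} (hℓ1 : 1 ≤ ℓ) (hy100 : 100 ≤ y) (hℓy : ℓ ≤ y / 400)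
    (hyℓ : Real.log y = ℓ) :
    2 * Real.exp (y / (40 * ℓ)) ≤ Real.exp y / y ^ 2 := by
  have hy0 : 0 < y := by linarith
  have hℓ0 : 0 < ℓ := by linarith
  rw [le_div_iff₀ (by positivity), sq_eq_exp_two_mul hy0 hyℓ]
  have h2 : (2 : ℝ) ≤ Real.exp 1 := by linarith [Real.add_one_le_exp (1 : ℝ)]
  have h40 : y / (40 * ℓ) ≤ y / 40 := by
    rw [div_le_div_iff₀ (by positivity) (by norm_num)]; nlinarith
  calc 2 * Real.exp (y / (40 * ℓ)) * Real.exp (2 * ℓ)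
      ≤ Real.exp 1 * Real.exp (y / (40 * ℓ)) * Real.exp (2 * ℓ) := by gcongr
    _ = Real.exp (1 + y / (40 * ℓ) + 2 * ℓ) := by rw [Real.exp_add, Real.exp_add]
    _ ≤ Real.exp y := Real.exp_le_exp.mpr (by linarith)

/-- `e^{y/2} ≤ e^y / y²` for `y` large. [folklore] -/
theorem exp_half_le {ℓ y : ℝ} (hℓ1 : 1 ≤ ℓ) (hy100 : 100 ≤ y) (hℓy : ℓ ≤ y / 400)
    (hyℓ : Real.log y = ℓ) :
    Real.exp (y / 2) ≤ Real.exp y / y ^ 2 := by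
  have hy0 : 0 < y := by linarith
  rw [le_div_iff₀ (by positivity), sq_eq_exp_two_mul hy0 hyℓ, ← Real.exp_add]
  exact Real.exp_le_exp.mpr (by linarith)

/-- The final bookkeeping, on real variables: `T ≤ S + Z`, `S ≤ X(V + E) + R`,
`X(V + E) ≤ C_V M + C_E M`, `R ≤ W`, `Z ≤ M`, `W ≤ M` give `T ≤ (C_V + C_E + 2) M`. [folklore] -/
theorem final_arith {T S Z V E R M W X CV CE : ℝ} (h1 : T ≤ S + Z) (h2 : S ≤ X * (V + E) + R)
    (h3 : X * (V + E) ≤ CV * M + CE * M) (h4 : R ≤ W) (h5 : Z ≤ M) (h6 : W ≤ M) :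
    T ≤ (CV + CE + 2) * M := by
  linarith

/-! ### The sieve bound -/

/-- The **covering step**: a prime `p ≤ X` with `p > ⌊z⌋` such that `p + h` has no prime factor in
`[P, Q]` avoids all the events `q ∣ p`, `q ∈ [P, Q] ∧ q ∣ p + h` for the primes `q ≤ z`; hence
`#{p ≤ X prime : p + h has no prime factor in [P, Q]} ≤ #{sifted m ∈ [1, X]} + ⌊z⌋ + 1`.
[cite: Lichtman2020, §2, proof of Thm 1.1 (2.5)] -/
theorem card_primes_shift_free_le_card_sifted_add (X h : ℕ) (P Q z : ℝ) (hQ : 0 ≤ Q) :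
    (#{p ∈ Nat.primesLE X | ¬ ∃ q ∈ (p + h).primeFactors, P ≤ (q : ℝ) ∧ (q : ℝ) ≤ Q} : ℝ) ≤
      (#{m ∈ Icc 1 X | ∀ q ∈ (Icc ⌈(2 : ℝ)⌉₊ ⌊z⌋₊).filter Nat.Prime,
          ¬ (q ∣ m ∨ ((⌈P⌉₊ ≤ q ∧ q ≤ ⌊Q⌋₊) ∧ q ∣ m + h))} : ℝ) + (⌊z⌋₊ + 1) := by
  classical
  have hsub : {p ∈ Nat.primesLE X | ¬ ∃ q ∈ (p + h).primeFactors, P ≤ (q : ℝ) ∧ (q : ℝ) ≤ Q} ⊆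
      {m ∈ Icc 1 X | ∀ q ∈ (Icc ⌈(2 : ℝ)⌉₊ ⌊z⌋₊).filter Nat.Prime,
          ¬ (q ∣ m ∨ ((⌈P⌉₊ ≤ q ∧ q ≤ ⌊Q⌋₊) ∧ q ∣ m + h))} ∪ range (⌊z⌋₊ + 1) := by
    intro p hp
    have hp' := Finset.mem_filter.mp hp
    have hpX : p ≤ X := (Nat.mem_primesLE.mp hp'.1).1
    have hpp : p.Prime := (Nat.mem_primesLE.mp hp'.1).2
    have hno := hp'.2
    rw [Finset.mem_union, Finset.mem_range]
    by_cases hpz : p < ⌊z⌋₊ + 1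
    · exact Or.inr hpz
    · refine Or.inl (Finset.mem_filter.mpr ⟨Finset.mem_Icc.mpr ⟨hpp.one_lt.le, hpX⟩, ?_⟩)
      intro q hq
      have hq' := Finset.mem_filter.mp hq
      have hqz : q ≤ ⌊z⌋₊ := (Finset.mem_Icc.mp hq'.1).2
      have hqp : q.Prime := hq'.2
      rintro (hdvd | ⟨⟨hPq, hqQ⟩, hdvd⟩)
      · have := (Nat.prime_dvd_prime_iff_eq hqp hpp).mp hdvd
        omega
      · refine hno ⟨q, Nat.mem_primeFactors.mpr ⟨hqp, hdvd, by omega⟩, Nat.ceil_le.mp hPq, ?_⟩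
        exact (Nat.le_floor_iff hQ).mp hqQ
  calc (#{p ∈ Nat.primesLE X | ¬ ∃ q ∈ (p + h).primeFactors, P ≤ (q : ℝ) ∧ (q : ℝ) ≤ Q} : ℝ)
      ≤ #({m ∈ Icc 1 X | ∀ q ∈ (Icc ⌈(2 : ℝ)⌉₊ ⌊z⌋₊).filter Nat.Prime,
          ¬ (q ∣ m ∨ ((⌈P⌉₊ ≤ q ∧ q ≤ ⌊Q⌋₊) ∧ q ∣ m + h))} ∪ range (⌊z⌋₊ + 1)) := by
        exact_mod_cast Finset.card_le_card hsub
    _ ≤ _ := by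
        have := Finset.card_union_le
          {m ∈ Icc 1 X | ∀ q ∈ (Icc ⌈(2 : ℝ)⌉₊ ⌊z⌋₊).filter Nat.Prime,
            ¬ (q ∣ m ∨ ((⌈P⌉₊ ≤ q ∧ q ≤ ⌊Q⌋₊) ∧ q ∣ m + h))} (range (⌊z⌋₊ + 1))
        rw [Finset.card_range] at this
        exact_mod_cast this

set_option maxHeartbeats 800000 in -- the sifted-set terms in the statements are large
/-- **The sieve bound at a fixed `X`, under explicit numerical conditions** on `y = log X`,
`ℓ = log y` (all of which hold for `X` large): for `1 ≤ h ≤ X` and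
`y ≤ P ≤ Q ≤ z = exp(y/(40ℓ))`,
`#{p ≤ X : p + h has no prime factor in [P, Q]} ≤ C₀ X (ℓ/y) (log P/log Q)` with
`C₀ = 40 log 2 · e^{6/log 2 + 8} + e^{32} + 2`. [cite: Lichtman2020, (2.5)] -/
theorem card_primes_shift_free_le_of {X h : ℕ} {P Q y ℓ z : ℝ} (hy : Real.log X = y)
    (hyℓ : Real.log y = ℓ) (hz : Real.exp (y / (40 * ℓ)) = z) (hh : 1 ≤ h) (hhX : h ≤ X)
    (hy100 : 100 ≤ y) (hℓ1 : 1 ≤ ℓ) (hℓy : ℓ ≤ y / 400) (hP : y ≤ P) (hPQ : P ≤ Q) (hQ : Q ≤ z) :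
    (#{p ∈ Nat.primesLE X | ¬ ∃ q ∈ (p + h).primeFactors, P ≤ (q : ℝ) ∧ (q : ℝ) ≤ Q} : ℝ) ≤
      (40 * Real.log 2 * Real.exp (6 / Real.log 2 + 8) + Real.exp 32 + 2) *
        (X * ℓ / y) * (Real.log P / Real.log Q) := by
  classical
  have hy0 : 0 < y := by linarith
  have hℓ0 : 0 < ℓ := by linarith
  have hX0 : (0 : ℝ) < X := by
    by_contra hcon
    have hle : (X : ℝ) ≤ 0 := not_lt.mp hcon
    have : Real.log (X : ℝ) ≤ 0 := Real.log_nonpos (Nat.cast_nonneg X) (by linarith)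
    linarith
  have hXexp : (X : ℝ) = Real.exp y := by rw [← hy, Real.exp_log hX0]
  have hP2 : 2 ≤ P := by linarith
  have hz2 : 2 ≤ z := hP2.trans (hPQ.trans hQ)
  have hz1 : 1 ≤ z := by linarith
  have hz0 : 0 < z := by linarith
  have hlogz : Real.log z = y / (40 * ℓ) := by rw [← hz, Real.log_exp]
  have hlogP : ℓ ≤ Real.log P := by rw [← hyℓ]; exact Real.log_le_log hy0 hP
  have hlogP0 : 0 < Real.log P := by linarith
  have hlogQ0 : 0 < Real.log Q := Real.log_pos (by linarith)
  have hlogQ : Real.log Q ≤ y / (40 * ℓ) := by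
    rw [← hlogz]; exact Real.log_le_log (by linarith) hQ
  have hLPQ0 : 0 < Real.log P / Real.log Q := div_pos hlogP0 hlogQ0
  -- `M = X (ℓ/y) (log P/log Q) ≥ X/y²`
  have hLPQlow : 40 * ℓ ^ 2 / y ≤ Real.log P / Real.log Q := by
    rw [div_le_div_iff₀ hy0 hlogQ0]
    calc 40 * ℓ ^ 2 * Real.log Q ≤ 40 * ℓ ^ 2 * (y / (40 * ℓ)) := by gcongr
      _ = ℓ * y := by field_simp
      _ ≤ Real.log P * y := by gcongr
  have hM0 : 0 < (X : ℝ) * ℓ / y * (Real.log P / Real.log Q) := by positivity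
  have hMlow : (X : ℝ) / y ^ 2 ≤ (X : ℝ) * ℓ / y * (Real.log P / Real.log Q) := by
    calc (X : ℝ) / y ^ 2 ≤ (X : ℝ) / y ^ 2 * (40 * ℓ ^ 3) := by
          refine le_mul_of_one_le_right (by positivity) ?_
          nlinarith [hℓ1]
      _ = (X : ℝ) * ℓ / y * (40 * ℓ ^ 2 / y) := by field_simp
      _ ≤ _ := by gcongr
  -- the parameter `r = 2⌈6ℓ⌉`
  have hr_lo : 12 * ℓ ≤ ((2 * ⌈6 * ℓ⌉₊ : ℕ) : ℝ) := by
    have : 6 * ℓ ≤ ⌈6 * ℓ⌉₊ := Nat.le_ceil _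
    push_cast; linarith
  have hr_hi : ((2 * ⌈6 * ℓ⌉₊ : ℕ) : ℝ) ≤ 12 * ℓ + 2 := by
    have : (⌈6 * ℓ⌉₊ : ℝ) < 6 * ℓ + 1 := Nat.ceil_lt_add_one (by positivity)
    push_cast; linarith
  -- Step 1: covering + Brun's pure sieve
  have hcover := card_primes_shift_free_le_card_sifted_add X h P Q z (by linarith)
  have hprime : ∀ q ∈ (Icc ⌈(2 : ℝ)⌉₊ ⌊z⌋₊).filter Nat.Prime, q.Prime := fun q hq =>
    (Finset.mem_filter.mp hq).2
  have hsieve := card_sifted_le _ hprime (fun q => ⌈P⌉₊ ≤ q ∧ q ≤ ⌊Q⌋₊) X h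
    (even_two_mul ⌈6 * ℓ⌉₊)
  -- Step 2: the main term
  have hFcard : (#(((Icc ⌈P⌉₊ ⌊Q⌋₊).filter Nat.Prime).filter (· ∣ h)) : ℝ) * Real.log P ≤ y := by
    have h1 := card_mul_log_le_log (by linarith : (1 : ℝ) ≤ P) hh
      (((Icc ⌈P⌉₊ ⌊Q⌋₊).filter Nat.Prime).filter (· ∣ h)) fun q hq => by
      have hq1 := Finset.mem_filter.mp hq
      have hq2 := Finset.mem_filter.mp hq1.1
      exact ⟨hq2.2, hq1.2, Nat.ceil_le.mp (Finset.mem_Icc.mp hq2.1).1⟩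
    refine h1.trans ?_
    rw [← hy]
    exact Real.log_le_log (by exact_mod_cast hh) (by exact_mod_cast hhX)
  have hFP : 2 * (#(((Icc ⌈P⌉₊ ⌊Q⌋₊).filter Nat.Prime).filter (· ∣ h)) : ℝ) / P ≤ 2 := by
    rw [div_le_iff₀ (by linarith)]
    have h2 : (#(((Icc ⌈P⌉₊ ⌊Q⌋₊).filter Nat.Prime).filter (· ∣ h)) : ℝ) ≤ y := by
      have := hFcard
      nlinarith [hlogP, hℓ1, Nat.cast_nonneg (α := ℝ)
        (#(((Icc ⌈P⌉₊ ⌊Q⌋₊).filter Nat.Prime).filter (· ∣ h)))]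
    nlinarith [hP]
  have hV : ∏ q ∈ (Icc ⌈(2 : ℝ)⌉₊ ⌊z⌋₊).filter Nat.Prime,
      (1 - (if (⌈P⌉₊ ≤ q ∧ q ≤ ⌊Q⌋₊) ∧ ¬ q ∣ h then (2 : ℝ) else 1) / q) ≤
      40 * Real.log 2 * Real.exp (6 / Real.log 2 + 8) * (ℓ / y) * (Real.log P / Real.log Q) := by
    refine (prod_one_sub_nu_le hP2 hPQ hQ h).trans ?_
    rw [hlogz]
    have hlog2 : 0 < Real.log 2 := Real.log_pos one_lt_two
    have e1 : Real.exp (6 / Real.log P) ≤ Real.exp 6 := by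
      refine Real.exp_le_exp.mpr ?_
      rw [div_le_iff₀ hlogP0]; nlinarith [hlogP, hℓ1]
    have e2 : Real.exp (2 * (#(((Icc ⌈P⌉₊ ⌊Q⌋₊).filter Nat.Prime).filter (· ∣ h)) : ℝ) / P) ≤
        Real.exp 2 := Real.exp_le_exp.mpr hFP
    have e3 : Real.log 2 / (y / (40 * ℓ)) = 40 * Real.log 2 * (ℓ / y) := by field_simp
    have e4 : Real.exp (6 / Real.log 2) * Real.exp 6 * Real.exp 2 = Real.exp (6 / Real.log 2 + 8) := by
      rw [← Real.exp_add, ← Real.exp_add]; congr 1; ring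
    rw [e3]
    calc Real.exp (6 / Real.log 2) * (40 * Real.log 2 * (ℓ / y)) *
          (Real.exp (6 / Real.log P) * (Real.log P / Real.log Q)) *
          Real.exp (2 * (#(((Icc ⌈P⌉₊ ⌊Q⌋₊).filter Nat.Prime).filter (· ∣ h)) : ℝ) / P)
        ≤ Real.exp (6 / Real.log 2) * (40 * Real.log 2 * (ℓ / y)) *
          (Real.exp 6 * (Real.log P / Real.log Q)) * Real.exp 2 := by gcongr
      _ = 40 * Real.log 2 * (Real.exp (6 / Real.log 2) * Real.exp 6 * Real.exp 2) * (ℓ / y) *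
          (Real.log P / Real.log Q) := by ring
      _ = _ := by rw [e4]
  -- Step 3: the Rankin term and the remainder
  have hℓz : Real.log (Real.log z) ≤ ℓ := by
    rw [hlogz]
    have h40 : y / (40 * ℓ) ≤ y := by
      rw [div_le_iff₀ (by positivity)]
      exact le_mul_of_one_le_right hy0.le (by linarith)
    calc Real.log (y / (40 * ℓ)) ≤ Real.log y := Real.log_le_log (by positivity) h40
      _ = ℓ := hyℓ
  have hE := rankin_term_le hz2 hℓz hy0 hyℓ
    (fun q => if (⌈P⌉₊ ≤ q ∧ q ≤ ⌊Q⌋₊) ∧ ¬ q ∣ h then (2 : ℝ) else 1)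
    (fun q => by positivity) (fun q => by split_ifs <;> norm_num) hr_lo
  have hR := remainder_term_le hz1 hlogz hℓ1 hy100 hℓy hr_hi
  -- Step 4: the small terms
  have hsmall1 : (⌊z⌋₊ : ℝ) + 1 ≤ (X : ℝ) * ℓ / y * (Real.log P / Real.log Q) := by
    have h1 : (⌊z⌋₊ : ℝ) + 1 ≤ 2 * z := by linarith [Nat.floor_le hz0.le]
    refine h1.trans (le_trans ?_ hMlow)
    rw [hXexp, ← hz]
    exact two_mul_z_le hℓ1 hy100 hℓy hyℓ
  have hsmall2 : Real.exp (y / 2) ≤ (X : ℝ) * ℓ / y * (Real.log P / Real.log Q) := by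
    refine le_trans ?_ hMlow
    rw [hXexp]
    exact exp_half_le hℓ1 hy100 hℓy hyℓ
  have hsmall3 : (X : ℝ) * (Real.exp 32 / y ^ 8) ≤
      Real.exp 32 * ((X : ℝ) * ℓ / y * (Real.log P / Real.log Q)) := by
    calc (X : ℝ) * (Real.exp 32 / y ^ 8) = Real.exp 32 * (X / y ^ 2) * (1 / y ^ 6) := by
          field_simp
      _ ≤ Real.exp 32 * (X / y ^ 2) * 1 := by
          gcongr
          rw [div_le_one (by positivity)]
          exact one_le_pow₀ (by linarith)
      _ ≤ _ := by rw [mul_one]; gcongr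
  -- Step 5: assemble
  have hmain : (X : ℝ) * (∏ q ∈ (Icc ⌈(2 : ℝ)⌉₊ ⌊z⌋₊).filter Nat.Prime,
        (1 - (if (⌈P⌉₊ ≤ q ∧ q ≤ ⌊Q⌋₊) ∧ ¬ q ∣ h then (2 : ℝ) else 1) / q) +
      ∑ S ∈ ((Icc ⌈(2 : ℝ)⌉₊ ⌊z⌋₊).filter Nat.Prime).powersetCard (2 * ⌈6 * ℓ⌉₊ + 1),
        ∏ q ∈ S, (if (⌈P⌉₊ ≤ q ∧ q ≤ ⌊Q⌋₊) ∧ ¬ q ∣ h then (2 : ℝ) else 1) / q) ≤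
      40 * Real.log 2 * Real.exp (6 / Real.log 2 + 8) *
          ((X : ℝ) * ℓ / y * (Real.log P / Real.log Q)) +
        Real.exp 32 * ((X : ℝ) * ℓ / y * (Real.log P / Real.log Q)) := by
    calc _ ≤ (X : ℝ) * (40 * Real.log 2 * Real.exp (6 / Real.log 2 + 8) * (ℓ / y) *
          (Real.log P / Real.log Q) + Real.exp 32 / y ^ 8) := by gcongr
      _ = 40 * Real.log 2 * Real.exp (6 / Real.log 2 + 8) *
            ((X : ℝ) * ℓ / y * (Real.log P / Real.log Q)) + X * (Real.exp 32 / y ^ 8) := by ring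
      _ ≤ _ := by gcongr
  have hfin := final_arith hcover hsieve hmain hR hsmall1 hsmall2
  exact hfin.trans_eq (mul_assoc _ _ _).symm

/-- **Shifted primes free of prime factors in `[P, Q]` (Lichtman's (2.5), weak form).** There are
`C, X₀` such that for all `X ≥ X₀`, `1 ≤ h ≤ X` and `log X ≤ P ≤ Q ≤ exp(log X/(40 log log X))`,
`#{p ≤ X : p + h has no prime factor in [P, Q]} ≤ C · (X log log X/log X) · (log P/log Q)`.
Printed (2.5): "`#{p ≤ X : q ∤ p + h ∀ q ∈ [P_j, Q_j]} ≪ π(X) (log P_j/log Q_j) (h/φ(h))`" for each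
`h ≤ H`, a standard sieve upper bound; the present form (which loses a factor `log log X` and covers
only sifting ranges `Q ≤ X^{1/(40 log log X)}`, where `h/φ(h)` restricted to the primes `≥ P ≥ log X`
is bounded) is what Brun's pure sieve gives and what the proof of Lichtman's Theorem 1.1 (power
range) consumes (`Literature.Lichtman2020.roughShiftedPrimesBound`).  "`p + h` has no prime factor in
`[P, Q]`" is spelled out (`¬ ∃ q ∈ (p + h).primeFactors, P ≤ q ≤ Q`); it is definitionally
`¬ Literature.HasPrimeFactorIn P Q (p + h)`. [cite: Lichtman2020, (2.5)] -/
theorem card_primes_shift_free_le :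
    ∃ C : ℝ, ∃ X₀ : ℕ, ∀ X : ℕ, X₀ ≤ X → ∀ h : ℕ, 1 ≤ h → h ≤ X → ∀ P Q : ℝ,
      Real.log X ≤ P → P ≤ Q → Q ≤ Real.exp (Real.log X / (40 * Real.log (Real.log X))) →
      (#{p ∈ Nat.primesLE X | ¬ ∃ q ∈ (p + h).primeFactors, P ≤ (q : ℝ) ∧ (q : ℝ) ≤ Q} : ℝ) ≤
        C * (X * Real.log (Real.log X) / Real.log X) * (Real.log P / Real.log Q) := by
  -- the numerical conditions hold eventually
  have e1 : ∀ᶠ X : ℕ in atTop, 100 ≤ Real.log X :=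
    (Real.tendsto_log_atTop.comp tendsto_natCast_atTop_atTop).eventually_ge_atTop _
  have e2 : ∀ᶠ X : ℕ in atTop, 1 ≤ Real.log (Real.log X) :=
    ((Real.tendsto_log_atTop.comp Real.tendsto_log_atTop).comp
      tendsto_natCast_atTop_atTop).eventually_ge_atTop _
  have e3 : ∀ᶠ X : ℕ in atTop, Real.log (Real.log X) ≤ Real.log X / 400 := by
    have h := (Real.isLittleO_log_id_atTop.comp_tendsto Real.tendsto_log_atTop).def
      (by norm_num : (0 : ℝ) < 1 / 400)
    have h' := tendsto_natCast_atTop_atTop (R := ℝ) |>.eventually h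
    filter_upwards [h', e1] with X hX hX1
    simp only [Function.comp, id] at hX
    have h0 : 0 ≤ Real.log (Real.log (X : ℝ)) := Real.log_nonneg (by linarith)
    rw [Real.norm_of_nonneg h0, Real.norm_of_nonneg (by linarith)] at hX
    linarith
  obtain ⟨X₀, hX₀⟩ := Filter.eventually_atTop.mp (e1.and (e2.and e3))
  refine ⟨40 * Real.log 2 * Real.exp (6 / Real.log 2 + 8) + Real.exp 32 + 2, X₀, ?_⟩
  intro X hX h hh hhX P Q hP hPQ hQ
  obtain ⟨h1, h2, h3⟩ := hX₀ X hX
  have := card_primes_shift_free_le_of (X := X) rfl rfl rfl hh hhX h1 h2 h3 hP hPQ hQ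
  simpa [mul_div_assoc] using this

end ShiftedPrimesSieve

end Literature.NumberTheory.Sieve
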